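import Summits.AtomisticToContinuum.Crystallization.Theorems.FreeSplittingCertificatesStrictSplittingRuleP1FarCellJensen12
import Summits.AtomisticToContinuum.Crystallization.Theorems.FreeSplittingCertificatesStrictSplittingRuleP1FarCellForm12B

/-!
# `StrictSplittingRule` (stmt-AtomisticToContinuum-12560): THE PER-KIND LOAD OF A LEG OF A CELL `≥ 12a` FROM THE BASE (P1 interpolant object, part 102)

Route `FreeSplittingCertificates`, crux r3 `StrictSplittingRule` (H12⋆ = `stub_coreJointCoercive`), unit b2b-freesplit-B gen 40.
VALUE = brick of the 12a re-basing of the (B∃) tail (HOME CERT §39 (f)): part 96's `leg_load_le20` from `12a`, with PER-KIND constants — in-layer legs: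
tension `53/50` (`r ≥ 23/2`, part 99), Jensen capacity `X = (103/100)m_b²` (lever `a/10`, `m_b ≥ 11`); routed vertical legs: tension `5/4` (`r ≥ 10`: the
second bond's base is `≥ 12a − 2h ≥ 10.07`), capacity `X = (11/10)m_b²` (lever `a/2`, `m_b ≥ 12a − h ≥ 217/20`) — so that the conclusion is
`θ_T(e)·(W_e + R_e) ≤ J_T·p1LoadCoef12` (`Λ_in = (53/50)(103/100)³`, `Λ_v = (5/4)(11/10)³`, part 100) and parts 100/101 (`p1ClassForm12 ≤ (18/125)|g|²`) apply.
* `load_bound_gen`, `carriers_moment_le_in11`, **`leg_load_le12`**, **`pair_load_le12`**, `pair_term_le12`.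
NOT a proof of H12⋆, NOT summit progress.  [folklore]
-/

noncomputable section

open Set Function Metric MeasureTheory Filter Topology
open scoped BigOperators NNReal ENNReal Classical

namespace Summit.AtomisticToContinuum.Crystallization.Theorems.StrictSplittingRuleBirth

open Literature.MathematicalPhysics.StatisticalMechanics
open Summit.AtomisticToContinuum.Crystallization.Theorems.PalmUnimodularRigidity.LayeredLawsSelectHcp

/-! ## One load, general constants -/

/-- **One load against the budget (abstract, parameters)**: `θ ≤ J/(nV·(c·m²)⁻³)`, `W ≤ A·t·(m²)⁻³` ⇒ `θ·W ≤ J·(A/(nV))·(t·c³)`. -/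
theorem load_bound_gen {θ J W A n V m c t : ℝ} (hθ0 : 0 ≤ θ) (hA0 : 0 ≤ A) (hn : 0 < n) (hV : 0 < V) (hm : 0 < m) (hc : 0 < c) (ht : 0 ≤ t)
    (hθ : θ ≤ J / (n * (V * ((c * m ^ 2)⁻¹) ^ 3))) (hW : W ≤ A * t * ((m ^ 2)⁻¹) ^ 3) :
    θ * W ≤ J * (A / (n * V) * (t * c ^ 3)) := by
  have hB0 : 0 ≤ A * t * ((m ^ 2)⁻¹) ^ 3 := by positivity
  calc θ * W ≤ θ * (A * t * ((m ^ 2)⁻¹) ^ 3) := mul_le_mul_of_nonneg_left hW hθ0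
    _ ≤ J / (n * (V * ((c * m ^ 2)⁻¹) ^ 3)) * (A * t * ((m ^ 2)⁻¹) ^ 3) := mul_le_mul_of_nonneg_right hθ hB0
    _ = J * (A / (n * V) * (t * c ^ 3)) := by
        have hm' : m ≠ 0 := hm.ne'
        have hn' : n ≠ 0 := hn.ne'
        have hV' : V ≠ 0 := hV.ne'
        have hc' : c ≠ 0 := hc.ne'
        field_simp

/-- Part 99's in-layer moment bound from `m_b ≥ 11` (the in-layer bond midpoint of a cell `≥ 12a` is `≥ 12a − a/2 ≥ 11.17`):
`(|T'|/4)ΣΣ|y − y_p|² ≤ n|T'|·((103/100)m²)` (`(m + 1/10)² + 3/5 ≤ (103/100)m²` for `m ≥ 11`). -/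
theorem carriers_moment_le_in11 {a h : ℝ} (ha : 0 < a) (hh : 0 < h) (ha2 : a ≤ 97139 / 100000) (hh2 : h ≤ 79304 / 100000)
    (p x d : ℤ × ℤ × ℤ) {b : Bool} (hb : p1Par x = b) (hd : d ∈ p1StencilIn) (hn : 0 < (p1Carriers b d).card)
    {m : ℝ} (hm0 : 0 ≤ m) (hm : 11 ≤ m)
    (hDμ : fpSq ((fun k => hcpSite a h x k - hcpSite a h p k) + fun k => p1FrameVec a h (p1Frame b d) k / 2) = m ^ 2) :
    √3 * a ^ 2 * h / 48 * ∑ oπ ∈ p1Carriers b d, ∑ m' : Fin 4,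
        fpSq (fun k => hcpSite a h ((x - oπ.1) + p1VertOff (p1Par (x - oπ.1)) oπ.2 m') k - hcpSite a h p k) ≤
      ((p1Carriers b d).card : ℝ) * (√3 * a ^ 2 * h / 12) * (103 / 100 * m ^ 2) := by
  rw [carrier_moment_eq a h hb d]
  obtain ⟨-, hA1, hA2, hA3, hV⟩ := p1CarCheck_in b d hd
  have hWin := p1CarCheckIn_all b d hd
  unfold p1CarCheckIn at hWin
  obtain ⟨-, hvar⟩ := check_real ha hh ha2 hh2 hn (p1CarCheck_in b d hd).1 hA1 hA2 hA3 hV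
  have hw := check_real_in ha hh ha2 hh2 hn hWin
  have hN : (0 : ℝ) < 4 * ((p1Carriers b d).card : ℝ) := by positivity
  have hsc : (m + 1 / 10) ^ 2 + 3 / 5 ≤ 103 / 100 * m ^ 2 := by nlinarith [mul_nonneg (sub_nonneg.2 hm) hm0]
  have key := moment_abstract_gen (D := fun k => hcpSite a h x k - hcpSite a h p k) (U := p1FrameVec a h (p1CarS1 b d))
    (μ := fun k => p1FrameVec a h (p1Frame b d) k / 2) hN hm0 (by norm_num) hDμ hw hvar hsc
  have hV0 : 0 ≤ √3 * a ^ 2 * h / 48 := by positivity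
  have := mul_le_mul_of_nonneg_left key hV0
  refine le_trans this (le_of_eq ?_)
  ring

/-- **THE LOAD OF ONE LEG OF A CELL `≥ 12a` FROM THE BASE, PER KIND**: for the hcp family minimiser, any base `p`, a cell `T`, a leg `(x, d)` with
`x`, `x + d` at distance `≥ 12a` from `y_p`, `x` of parity `bx`, any shed set `φ`:
`θ_T(x,d)·(p1FarW φ p (x,d) + p1RouteW φ p (x,d)) ≤ J_T·([d ∈ p1StencilIn]·c_in(n)·Λ_in + [d ∈ p1RouteDirs bx]·c_v(n)·Λ_v)` — in-layer: tension `53/50`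
(`r ≥ 23/2`), capacity `X = (103/100)m_b²` (`m_b ≥ 11`); routed: tension `5/4` (`r ≥ 10`), capacity `X = (11/10)m_b²` (`m_b ≥ 217/20`).  NOT a proof of H12⋆, NOT summit progress. [folklore] -/
theorem leg_load_le12 {a h : ℝ} (ha : 0 < a) (hh : 0 < h) (hfam : HcpFamilyMin a h) (φ : Finset ((ℤ × ℤ × ℤ) × (ℤ × ℤ × ℤ)))
    (p : ℤ × ℤ × ℤ) (T : (ℤ × ℤ × ℤ) × Fin 6) (x d : ℤ × ℤ × ℤ) {bx : Bool} (hbx : p1Par x = bx)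
    (hRx : 12 * a ≤ ‖hcpSite a h x - hcpSite a h p‖) (hRx' : 12 * a ≤ ‖hcpSite a h (x + d) - hcpSite a h p‖) :
    p1ThetaX a h p (x, d) T * (p1FarW a h φ p (x, d) + p1RouteW a h φ p (x, d)) ≤
      p1CellJ a h p T *
        ((Nat.cast (R := ℝ) (if d ∈ p1StencilIn then (p1Carriers bx d).card else 0))⁻¹ * (2 / (3 * a ^ 2) / (24 * (√3 * a ^ 2 * h / 12))) * p1LamIn +
          (Nat.cast (R := ℝ) (if d ∈ p1RouteDirs bx then (p1Carriers bx d).card else 0))⁻¹ *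
            (2 * (2 / 3) * (1 / (4 * h ^ 2)) / (24 * (√3 * a ^ 2 * h / 12))) * p1LamV) := by
  -- the box
  obtain ⟨hA, hH⟩ := hcpFamilyMin_enclosure ha hh hfam
  rw [abs_sub_le_iff] at hA hH
  obtain ⟨hA1, hA2⟩ := hA
  obtain ⟨hH1, hH2⟩ := hH
  obtain ⟨hρ1, hρ2⟩ := ratioBox_of_hcpFamilyMin ha hh hfam
  have ha' : a ≤ 8 / 5 := by linarith
  have hh' : h ≤ 4 / 5 := by linarith
  have ha2 : a ≤ 97139 / 100000 := by linarith
  have hh2 : h ≤ 79304 / 100000 := by linarith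
  have h3 : 0 < √3 := Real.sqrt_pos.2 (by norm_num)
  have hV0 : 0 < √3 * a ^ 2 * h / 12 := by positivity
  have hϱ0 : 0 ≤ √(4 * a ^ 2 / 3 + h ^ 2) := Real.sqrt_nonneg _
  have hϱle : √(4 * a ^ 2 / 3 + h ^ 2) ≤ 99 / 70 * a := starRad_le ha hh hρ2
  have hRx10 : 10 ≤ ‖hcpSite a h x - hcpSite a h p‖ := by linarith
  have hRx115 : 23 / 2 ≤ ‖hcpSite a h x - hcpSite a h p‖ := by linarith
  have ha1 : a ≤ 1 := by linarith
  have hxp : x ≠ p := by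
    intro hxp; rw [hxp, sub_self, norm_zero] at hRx; linarith
  have hfarx : 27 / 5 * a + √(4 * a ^ 2 / 3 + h ^ 2) ≤ ‖hcpSite a h x - hcpSite a h p‖ := by linarith
  have hJ0 : 0 ≤ p1CellJ a h p T := p1CellJ_nonneg a h p T
  have hθ0 : 0 ≤ p1ThetaX a h p (x, d) T := p1ThetaX_nonneg a h p (x, d) T
  have hDx : ∀ k, hcpSite a h (x + d) k - hcpSite a h p k =
      (hcpSite a h x k - hcpSite a h p k) + p1FrameVec a h (p1Frame bx d) k := by
    intro k; rw [← hcpSite_shift_eq_frame a h hbx d k]; ring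
  -- the in-layer part
  have part_in : p1ThetaX a h p (x, d) T * p1FarW a h φ p (x, d) ≤ p1CellJ a h p T *
      ((Nat.cast (R := ℝ) (if d ∈ p1StencilIn then (p1Carriers bx d).card else 0))⁻¹ * (2 / (3 * a ^ 2) / (24 * (√3 * a ^ 2 * h / 12))) *
        p1LamIn) := by
    by_cases hdin : d ∈ p1StencilIn
    · rw [if_pos hdin]
      have hnposN : 0 < (p1Carriers bx d).card := p1Carriers_card_pos_in bx d hdin
      have hnpos : (0 : ℝ) < ((p1Carriers bx d).card : ℝ) := by exact_mod_cast hnposN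
      -- the bond midpoint distance
      set mb : ℝ := ‖(hcpSite a h x - hcpSite a h p) + (1 / 2 : ℝ) • hcpSite a h d‖ with hmb
      have hmbge : ‖hcpSite a h x - hcpSite a h p‖ - 1 / 2 * a ≤ mb := by
        have := norm_add_half_ge (hcpSite a h x - hcpSite a h p) (hcpSite a h d)
        rw [norm_stencilIn ha hdin] at this
        linarith only [this]
      have hmb0 : 0 ≤ mb := norm_nonneg _
      have hmb1 : 11 ≤ mb := by linarith
      have hmbpos : 0 < mb := by linarith
      have hDμ : fpSq ((fun k => hcpSite a h x k - hcpSite a h p k) + fun k => p1FrameVec a h (p1Frame bx d) k / 2) = mb ^ 2 := by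
        rw [hmb, norm_sq_eq_fpSq]
        congr 1
        funext k
        simp only [PiLp.add_apply, PiLp.sub_apply, PiLp.smul_apply, smul_eq_mul, Pi.add_apply,
          hcpSite_stencilIn_eq_frame a h hdin bx k]
        ring
      -- capacity by Jensen
      have hmom := carriers_moment_le_in11 ha hh ha2 hh2 p x d hbx hdin hnposN hmb0 hmb1 hDμ
      have hX : (0 : ℝ) < 103 / 100 * mb ^ 2 := mul_pos (by norm_num) (pow_pos hmbpos 2)
      have hcap := cap_ge_carriers_tangent ha hh p x d hbx hfarx hX hmom
      have hL : (0 : ℝ) < ((p1Carriers bx d).card : ℝ) * (√3 * a ^ 2 * h / 12 * ((103 / 100 * mb ^ 2)⁻¹) ^ 3) :=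
        mul_pos hnpos (mul_pos hV0 (pow_pos (inv_pos.2 hX) 3))
      have hθle := p1ThetaX_le_div T hL hcap
      -- tension at the midpoint
      have hlam : p1TrussLam a h d = 2 / (3 * a ^ 2) := by rw [p1TrussLam_eq, if_pos (p1StencilIn_fst hdin)]
      have hW := p1FarW_le_mid_in12 ha hh ha1 φ p x d hdin hxp hRx115
      rw [hlam] at hW
      have hA0 : (0 : ℝ) ≤ 2 / (3 * a ^ 2) / 24 := by positivity
      have hW' : p1FarW a h φ p (x, d) ≤ 2 / (3 * a ^ 2) / 24 * (53 / 50) * ((mb ^ 2)⁻¹) ^ 3 := hW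
      have key := load_bound_gen hθ0 hA0 hnpos hV0 hmbpos (by norm_num : (0:ℝ) < 103 / 100) (by norm_num : (0:ℝ) ≤ 53 / 50) hθle hW'
      refine key.trans (le_of_eq ?_)
      rw [show (53 / 50 : ℝ) * (103 / 100) ^ 3 = p1LamIn from rfl]
      generalize p1CellJ a h p T = J
      generalize ((p1Carriers bx d).card : ℝ) = n
      generalize p1LamIn = L
      ring
    · rw [if_neg hdin, p1FarW_eq_zero_of φ p x hdin, mul_zero, Nat.cast_zero, inv_zero, zero_mul, zero_mul, mul_zero]
  -- the routed vertical part
  have part_v : p1ThetaX a h p (x, d) T * p1RouteW a h φ p (x, d) ≤ p1CellJ a h p T *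
      ((Nat.cast (R := ℝ) (if d ∈ p1RouteDirs bx then (p1Carriers bx d).card else 0))⁻¹ *
        (2 * (2 / 3) * (1 / (4 * h ^ 2)) / (24 * (√3 * a ^ 2 * h / 12))) * p1LamV) := by
    by_cases hdv : d ∈ p1RouteDirs bx
    · rw [if_pos hdv]
      have hnposN : 0 < (p1Carriers bx d).card := p1Carriers_card_pos_route bx d hdv
      have hnpos : (0 : ℝ) < ((p1Carriers bx d).card : ℝ) := by exact_mod_cast hnposN
      have hlam : p1TrussLam a h p1SV = 1 / (4 * h ^ 2) := by rw [p1TrussLam_eq, if_neg (by decide : ¬(p1SV.1 = 0))]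
      have hA0 : (0 : ℝ) ≤ 1 / (4 * h ^ 2) / 24 := by positivity
      -- bond 1 (based at `x`): midpoint `y_x + (0,0,h)`
      set m₁ : ℝ := ‖(hcpSite a h x - hcpSite a h p) + (1 / 2 : ℝ) • hcpSite a h p1SV‖ with hm₁
      have hm₁ge : ‖hcpSite a h x - hcpSite a h p‖ - h ≤ m₁ := by
        have := norm_add_half_ge (hcpSite a h x - hcpSite a h p) (hcpSite a h p1SV)
        rw [norm_p1SV hh] at this
        linarith only [this]
      have hm₁0 : 0 ≤ m₁ := norm_nonneg _
      have hm₁1 : 217 / 20 ≤ m₁ := by linarith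
      have hm₁pos : 0 < m₁ := by linarith
      have hDμ₁ : fpSq ((fun k => hcpSite a h x k - hcpSite a h p k) + fun k => p1FrameVec a h (0, 0, 2) k / 2) = m₁ ^ 2 := by
        rw [hm₁, norm_sq_eq_fpSq]
        congr 1
        funext k
        simp only [PiLp.add_apply, PiLp.sub_apply, PiLp.smul_apply, smul_eq_mul, Pi.add_apply, hcpSite_p1SV_eq_frame a h k]
        ring
      have hmom₁ := carriers_moment_le_v ha hh ha2 hh2 p x d hbx (p1CarCheck_v1 bx d hdv) hnposN hm₁0 hm₁1 hDμ₁
      have hX₁ : (0 : ℝ) < 11 / 10 * m₁ ^ 2 := mul_pos (by norm_num) (pow_pos hm₁pos 2)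
      have hcap₁ := cap_ge_carriers_tangent ha hh p x d hbx hfarx hX₁ hmom₁
      have hL₁ : (0 : ℝ) < ((p1Carriers bx d).card : ℝ) * (√3 * a ^ 2 * h / 12 * ((11 / 10 * m₁ ^ 2)⁻¹) ^ 3) :=
        mul_pos hnpos (mul_pos hV0 (pow_pos (inv_pos.2 hX₁) 3))
      have hθ₁ := p1ThetaX_le_div T hL₁ hcap₁
      have hW₁ := p1FarWv_le_mid10 ha hh ha' hh' φ p x hxp hRx10
      rw [hlam] at hW₁
      have hW₁' : p1FarWv a h φ p x ≤ 1 / (4 * h ^ 2) / 24 * (5 / 4) * ((m₁ ^ 2)⁻¹) ^ 3 := hW₁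
      have key₁ := load_bound_gen hθ0 hA0 hnpos hV0 hm₁pos (by norm_num : (0:ℝ) < 11 / 10) (by norm_num : (0:ℝ) ≤ 5 / 4) hθ₁
        (le_refl (1 / (4 * h ^ 2) / 24 * (5 / 4) * ((m₁ ^ 2)⁻¹) ^ 3))
      -- bond 2 (based at `x − (SV − d)`, head `x + d`): midpoint `y_{x+d} − (0,0,h)`
      have hq'x : x - (p1SV - d) + p1SV = x + d := by abel
      have hvec : hcpSite a h (x + d) - hcpSite a h (x - (p1SV - d)) = hcpSite a h p1SV := by
        rw [← hq'x]; exact sub_eq_p1SV a h _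
      have hRqge : ‖hcpSite a h (x + d) - hcpSite a h p‖ - 2 * h ≤ ‖hcpSite a h (x - (p1SV - d)) - hcpSite a h p‖ := by
        have htri := norm_sub_le_norm_sub_add_norm_sub (hcpSite a h (x + d)) (hcpSite a h (x - (p1SV - d))) (hcpSite a h p)
        rw [hvec, norm_p1SV hh] at htri
        linarith only [htri]
      have hRq10 : 10 ≤ ‖hcpSite a h (x - (p1SV - d)) - hcpSite a h p‖ := by linarith only [hRqge, hRx', hA2, hH1]
      have hq'p : x - (p1SV - d) ≠ p := by
        intro hq; rw [hq, sub_self, norm_zero] at hRq10; linarith only [hRq10]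
      have hid : (hcpSite a h (x - (p1SV - d)) - hcpSite a h p) + (1 / 2 : ℝ) • hcpSite a h p1SV =
          (hcpSite a h (x + d) - hcpSite a h p) + (1 / 2 : ℝ) • (-hcpSite a h p1SV) := by
        rw [← hvec, smul_neg]; module
      set m₂ : ℝ := ‖(hcpSite a h (x - (p1SV - d)) - hcpSite a h p) + (1 / 2 : ℝ) • hcpSite a h p1SV‖ with hm₂
      have hm₂ge : ‖hcpSite a h (x + d) - hcpSite a h p‖ - h ≤ m₂ := by
        have := norm_add_half_ge (hcpSite a h (x + d) - hcpSite a h p) (-hcpSite a h p1SV)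
        rw [norm_neg, norm_p1SV hh, ← hid] at this
        linarith only [this]
      have hm₂0 : 0 ≤ m₂ := norm_nonneg _
      have hm₂1 : 217 / 20 ≤ m₂ := by linarith
      have hm₂pos : 0 < m₂ := by linarith
      have hDμ₂ : fpSq ((fun k => hcpSite a h x k - hcpSite a h p k) + fun k => p1FrameVec a h (2 • p1Frame bx d - (0, 0, 2)) k / 2) = m₂ ^ 2 := by
        rw [hm₂, hid, norm_sq_eq_fpSq]
        congr 1
        funext k
        simp only [PiLp.add_apply, PiLp.sub_apply, PiLp.smul_apply, PiLp.neg_apply, smul_eq_mul, Pi.add_apply, hDx k,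
          hcpSite_p1SV_eq_frame a h k, p1FrameVec_two_smul_sub]
        ring
      have hmom₂ := carriers_moment_le_v ha hh ha2 hh2 p x d hbx (p1CarCheck_v2 bx d hdv) hnposN hm₂0 hm₂1 hDμ₂
      have hX₂ : (0 : ℝ) < 11 / 10 * m₂ ^ 2 := mul_pos (by norm_num) (pow_pos hm₂pos 2)
      have hcap₂ := cap_ge_carriers_tangent ha hh p x d hbx hfarx hX₂ hmom₂
      have hL₂ : (0 : ℝ) < ((p1Carriers bx d).card : ℝ) * (√3 * a ^ 2 * h / 12 * ((11 / 10 * m₂ ^ 2)⁻¹) ^ 3) :=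
        mul_pos hnpos (mul_pos hV0 (pow_pos (inv_pos.2 hX₂) 3))
      have hθ₂ := p1ThetaX_le_div T hL₂ hcap₂
      have hW₂ := p1FarWv_le_mid10 ha hh ha' hh' φ p (x - (p1SV - d)) hq'p hRq10
      rw [hlam] at hW₂
      have hW₂' : p1FarWv a h φ p (x - (p1SV - d)) ≤ 1 / (4 * h ^ 2) / 24 * (5 / 4) * ((m₂ ^ 2)⁻¹) ^ 3 := hW₂
      have key₂ := load_bound_gen hθ0 hA0 hnpos hV0 hm₂pos (by norm_num : (0:ℝ) < 11 / 10) (by norm_num : (0:ℝ) ≤ 5 / 4) hθ₂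
        (le_refl (1 / (4 * h ^ 2) / 24 * (5 / 4) * ((m₂ ^ 2)⁻¹) ^ 3))
      -- the routed weight against the two bounds
      have hB₁ : (0 : ℝ) ≤ 1 / (4 * h ^ 2) / 24 * (5 / 4) * ((m₁ ^ 2)⁻¹) ^ 3 :=
        mul_nonneg (mul_nonneg hA0 (by norm_num)) (pow_nonneg (inv_nonneg.2 (sq_nonneg _)) 3)
      have hB₂ : (0 : ℝ) ≤ 1 / (4 * h ^ 2) / 24 * (5 / 4) * ((m₂ ^ 2)⁻¹) ^ 3 :=
        mul_nonneg (mul_nonneg hA0 (by norm_num)) (pow_nonneg (inv_nonneg.2 (sq_nonneg _)) 3)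
      have hRle := p1RouteW_le φ p x d hB₁ hB₂ hW₁' hW₂'
      have fin := route_combine hθ0 hRle key₁ key₂
      refine fin.trans (le_of_eq ?_)
      rw [show (5 / 4 : ℝ) * (11 / 10) ^ 3 = p1LamV from rfl]
      generalize p1CellJ a h p T = J
      generalize ((p1Carriers bx d).card : ℝ) = n
      generalize p1LamV = L
      ring
    · rw [if_neg hdv, p1RouteW_eq_zero_of φ p x (hbx ▸ hdv), mul_zero, Nat.cast_zero, inv_zero, zero_mul, zero_mul, mul_zero]
  rw [mul_add, mul_add]
  exact add_le_add part_in part_v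

/-- **The load of one vertex pair of a cell `≥ 12a` from the base, per kind**: `θ_T(e)·(p1FarW e + p1RouteW e) ≤ J_T · p1LoadCoef12 b π m m'`. [folklore] -/
theorem pair_load_le12 {a h : ℝ} (ha : 0 < a) (hh : 0 < h) (hfam : HcpFamilyMin a h) (φ : Finset ((ℤ × ℤ × ℤ) × (ℤ × ℤ × ℤ)))
    (p : ℤ × ℤ × ℤ) (T : (ℤ × ℤ × ℤ) × Fin 6) {b : Bool} (hb : p1Par T.1 = b) (m m' : Fin 4)
    (hRm : 12 * a ≤ ‖hcpSite a h (T.1 + p1VertOff b T.2 m) - hcpSite a h p‖)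
    (hRm' : 12 * a ≤ ‖hcpSite a h (T.1 + p1VertOff b T.2 m') - hcpSite a h p‖) :
    p1ThetaX a h p (T.1 + p1VertOff b T.2 m, p1VertOff b T.2 m' - p1VertOff b T.2 m) T *
        (p1FarW a h φ p (T.1 + p1VertOff b T.2 m, p1VertOff b T.2 m' - p1VertOff b T.2 m) +
          p1RouteW a h φ p (T.1 + p1VertOff b T.2 m, p1VertOff b T.2 m' - p1VertOff b T.2 m)) ≤
      p1CellJ a h p T * p1LoadCoef12 a h b T.2 m m' := by
  have hbx : p1Par (T.1 + p1VertOff b T.2 m) = parOf b (p1VertOff b T.2 m) := by rw [p1Par_add, hb]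
  have hxd : T.1 + p1VertOff b T.2 m + (p1VertOff b T.2 m' - p1VertOff b T.2 m) = T.1 + p1VertOff b T.2 m' := by abel
  have key := leg_load_le12 ha hh hfam φ p T (T.1 + p1VertOff b T.2 m) (p1VertOff b T.2 m' - p1VertOff b T.2 m) hbx hRm
    (by rw [hxd]; exact hRm')
  rw [p1LoadCoef12, p1LoadNIn, p1LoadNV]
  exact key

/-- One vertex pair's term of the budget against `J_T · p1LoadCoef · Σ_k ⟪δ, G_{·k}⟫²`, cells `≥ 12a` from the base, per-kind coefficients. -/
theorem pair_term_le12 {a h : ℝ} (ha : 0 < a) (hh : 0 < h) (hfam : HcpFamilyMin a h) (φ : Finset ((ℤ × ℤ × ℤ) × (ℤ × ℤ × ℤ)))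
    (p : ℤ × ℤ × ℤ) (T : (ℤ × ℤ × ℤ) × Fin 6)
    (hfar : ∀ m : Fin 4, 12 * a ≤ ‖hcpSite a h (T.1 + p1VertOff (p1Par T.1) T.2 m) - hcpSite a h p‖)
    (G : Fin 3 → Fin 3 → ℝ) (m m' : Fin 4) :
    let e : (ℤ × ℤ × ℤ) × (ℤ × ℤ × ℤ) := (T.1 + p1VertOff (p1Par T.1) T.2 m, p1VertOff (p1Par T.1) T.2 m' - p1VertOff (p1Par T.1) T.2 m)
    p1ThetaX a h p e T * p1FarW a h φ p e *
        fpSq (fun k => (hcpSite a h (e.1 + e.2) 0 - hcpSite a h e.1 0) * G 0 k +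
          (hcpSite a h (e.1 + e.2) 1 - hcpSite a h e.1 1) * G 1 k + (hcpSite a h (e.1 + e.2) 2 - hcpSite a h e.1 2) * G 2 k) +
      p1ThetaX a h p e T * p1RouteW a h φ p e *
        fpSq (fun k => (hcpSite a h (e.1 + e.2) 0 - hcpSite a h e.1 0) * G 0 k +
          (hcpSite a h (e.1 + e.2) 1 - hcpSite a h e.1 1) * G 1 k + (hcpSite a h (e.1 + e.2) 2 - hcpSite a h e.1 2) * G 2 k) ≤
      p1CellJ a h p T * (p1LoadCoef12 a h (p1Par T.1) T.2 m m' *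
        ((p1EdgeVec a h (p1Par T.1) T.2 m m' 0 * G 0 0 + p1EdgeVec a h (p1Par T.1) T.2 m m' 1 * G 1 0 + p1EdgeVec a h (p1Par T.1) T.2 m m' 2 * G 2 0) ^ 2 +
         (p1EdgeVec a h (p1Par T.1) T.2 m m' 0 * G 0 1 + p1EdgeVec a h (p1Par T.1) T.2 m m' 1 * G 1 1 + p1EdgeVec a h (p1Par T.1) T.2 m m' 2 * G 2 1) ^ 2 +
         (p1EdgeVec a h (p1Par T.1) T.2 m m' 0 * G 0 2 + p1EdgeVec a h (p1Par T.1) T.2 m m' 1 * G 1 2 + p1EdgeVec a h (p1Par T.1) T.2 m m' 2 * G 2 2) ^ 2)) := by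
  intro e
  have hx : e.1 + e.2 = T.1 + p1VertOff (p1Par T.1) T.2 m' := by
    show T.1 + p1VertOff (p1Par T.1) T.2 m + (p1VertOff (p1Par T.1) T.2 m' - p1VertOff (p1Par T.1) T.2 m) = _
    abel
  have he1 : e.1 = T.1 + p1VertOff (p1Par T.1) T.2 m := rfl
  have hvec : ∀ j : Fin 3, hcpSite a h (e.1 + e.2) j - hcpSite a h e.1 j = p1EdgeVec a h (p1Par T.1) T.2 m m' j := by
    intro j; rw [hx, he1]; exact edgeVec_eq a h T rfl m m' j
  have hF : fpSq (fun k => (hcpSite a h (e.1 + e.2) 0 - hcpSite a h e.1 0) * G 0 k +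
      (hcpSite a h (e.1 + e.2) 1 - hcpSite a h e.1 1) * G 1 k + (hcpSite a h (e.1 + e.2) 2 - hcpSite a h e.1 2) * G 2 k) =
      (p1EdgeVec a h (p1Par T.1) T.2 m m' 0 * G 0 0 + p1EdgeVec a h (p1Par T.1) T.2 m m' 1 * G 1 0 + p1EdgeVec a h (p1Par T.1) T.2 m m' 2 * G 2 0) ^ 2 +
      (p1EdgeVec a h (p1Par T.1) T.2 m m' 0 * G 0 1 + p1EdgeVec a h (p1Par T.1) T.2 m m' 1 * G 1 1 + p1EdgeVec a h (p1Par T.1) T.2 m m' 2 * G 2 1) ^ 2 +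
      (p1EdgeVec a h (p1Par T.1) T.2 m m' 0 * G 0 2 + p1EdgeVec a h (p1Par T.1) T.2 m m' 1 * G 1 2 + p1EdgeVec a h (p1Par T.1) T.2 m m' 2 * G 2 2) ^ 2 := by
    simp only [fpSq, hvec]
  rw [hF, ← add_mul]
  have hF0 : 0 ≤ (p1EdgeVec a h (p1Par T.1) T.2 m m' 0 * G 0 0 + p1EdgeVec a h (p1Par T.1) T.2 m m' 1 * G 1 0 + p1EdgeVec a h (p1Par T.1) T.2 m m' 2 * G 2 0) ^ 2 +
      (p1EdgeVec a h (p1Par T.1) T.2 m m' 0 * G 0 1 + p1EdgeVec a h (p1Par T.1) T.2 m m' 1 * G 1 1 + p1EdgeVec a h (p1Par T.1) T.2 m m' 2 * G 2 1) ^ 2 +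
      (p1EdgeVec a h (p1Par T.1) T.2 m m' 0 * G 0 2 + p1EdgeVec a h (p1Par T.1) T.2 m m' 1 * G 1 2 + p1EdgeVec a h (p1Par T.1) T.2 m m' 2 * G 2 2) ^ 2 := by
    positivity
  have key := pair_load_le12 ha hh hfam φ p T (b := p1Par T.1) rfl m m' (hfar m) (hfar m')
  rw [mul_add] at key
  rw [← mul_assoc]
  exact mul_le_mul_of_nonneg_right key hF0

end Summit.AtomisticToContinuum.Crystallization.Theorems.StrictSplittingRuleBirth

end
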